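import Mathlib.MeasureTheory.Constructions.HaarToSphere
import Mathlib.Analysis.SpecialFunctions.Pow.Integral
import Mathlib.Analysis.SpecialFunctions.ImproperIntegrals
import Mathlib.Analysis.Calculus.MeanValue
import Mathlib.MeasureTheory.Group.LIntegral
import HarnessLib

/-!
# Hörmander's condition from a gradient bound (Stein 1970, Ch. II §2.2 and §3.2)

Analysis/SingularIntegrals support file of the Calderón–Zygmund `L^p` theory of this directory
(`CalderonZygmundLp.exists_eLpNorm_le` takes Hörmander's condition
`∫_{|x| ≥ 2|y|} |k(x - y) - k(x)| dx ≤ B` as a hypothesis). Everything here is PROVED, in every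
dimension `n ≥ 1` (a finite-dimensional real normed space `E` with an additive Haar measure `μ`):

* `integral_compl_ball_norm_rpow_neg`, `lintegral_compl_ball_norm_rpow_neg`: the radial tail
  integral `∫_{|z| ≥ r} |z|^{-t} dz = n|B₁| r^{n-t}/(t-n)` for `t > n`, `r > 0` (polar
  coordinates, Mathlib's `integral_fun_norm_addHaar`);
* `lintegral_hormander_le_of_norm_fderiv_le` — **Stein 1970, Ch. II §2.2, remark after (2)**:
  *the condition `|∇K(x)| ≤ C|x|^{-n-1}` implies `∫_{|x|≥2|y|} |K(x-y) - K(x)| dx ≤ B`* (mean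
  value theorem on the ball `B̄(x, |y|)`, on which `|w| ≥ |x|/2`, and the tail integral with
  `t = n + 1`), with the explicit constant `B = C 2ⁿ n |B₁|`;
* `lintegral_hormander_le_two_mul_lintegral`: the trivial bound
  `∫_{|x|≥2|y|} |k(x-y) - k(x)| dx ≤ 2‖k‖₁` for integrable perturbations, and
  `lintegral_hormander_add_le`: subadditivity of the Hörmander integral in the kernel.

These serve the discharge of Stein's `L^p` bound for the Hessian in general dimension
(`FluidPDE/HessianLaplacianLpGeneralProofs`), where the kernel is a truncated time integral of
second derivatives of the heat kernel: the main part has `|∇k| ≤ C|x|^{-n-1}` and the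
truncation terms are `L¹`-small.

## References

* E. M. Stein, *Singular integrals and differentiability properties of functions*, Princeton
  Math. Series 30 (1970), Ch. II §2.2 (conditions (2) and (2')), §3.2 Theorem 2. [`Stein1971`]
-/

noncomputable section

open MeasureTheory Metric Set Filter Function
open scoped ENNReal NNReal Topology

namespace Literature.Analysis.SingularIntegrals

variable {E : Type*} [NormedAddCommGroup E] [NormedSpace ℝ E] [FiniteDimensional ℝ E]
  [MeasurableSpace E] [BorelSpace E] (μ : Measure E) [μ.IsAddHaarMeasure]

/-! ### The radial tail integral `∫_{|z| ≥ r} |z|^{-t}` -/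

omit [FiniteDimensional ℝ E] [MeasurableSpace E] [BorelSpace E] in
/-- `y^{n-1} y^{-t} = y^{n-1-t}` for `y > 0`, `n ≥ 1`. [folklore] -/
theorem pow_pred_mul_rpow_neg {n : ℕ} (hn : 1 ≤ n) (t : ℝ) {y : ℝ} (hy : 0 < y) :
    y ^ (n - 1) * y ^ (-t) = y ^ ((n : ℝ) - 1 - t) := by
  rw [← Real.rpow_natCast, ← Real.rpow_add hy, Nat.cast_sub hn, Nat.cast_one]
  rfl

/-- The one-dimensional integral behind the tail: for `n ≥ 1`, `t > n`, `r > 0`,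
`∫_{y > 0} y^{n-1} 𝟙_{[r,∞)}(y) y^{-t} dy = r^{n-t}/(t-n)`. [folklore] -/
theorem setIntegral_Ioi_pow_smul_indicator_rpow_neg {n : ℕ} (hn : 1 ≤ n) {t r : ℝ}
    (ht : (n : ℝ) < t) (hr : 0 < r) :
    ∫ y in Ioi (0 : ℝ), y ^ (n - 1) • (Ici r).indicator (fun y : ℝ => y ^ (-t)) y =
      r ^ ((n : ℝ) - t) / (t - n) := by
  have e : (fun y : ℝ => y ^ (n - 1) • (Ici r).indicator (fun y : ℝ => y ^ (-t)) y) =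
      (Ici r).indicator fun y => y ^ (n - 1) * y ^ (-t) := by
    funext y
    by_cases hy : y ∈ Ici r
    · simp [indicator_of_mem hy]
    · simp [indicator_of_notMem hy]
  have hI : Ioi (0 : ℝ) ∩ Ici r = Ici r := inter_eq_right.2 fun y hy => lt_of_lt_of_le hr hy
  rw [e, setIntegral_indicator measurableSet_Ici, hI, integral_Ici_eq_integral_Ioi]
  have h2 : ∫ y in Ioi r, y ^ (n - 1) * y ^ (-t) = ∫ y in Ioi r, y ^ ((n : ℝ) - 1 - t) :=
    setIntegral_congr_fun measurableSet_Ioi fun y hy => pow_pred_mul_rpow_neg hn t (hr.trans hy)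
  rw [h2, integral_Ioi_rpow_of_lt (by linarith : ((n : ℝ) - 1 - t) < -1) hr]
  have h3 : ((n : ℝ) - 1 - t + 1) = (n : ℝ) - t := by ring
  rw [h3, ← neg_div_neg_eq, neg_neg, neg_sub]

/-- **Radial power integral off a ball** in dimension `n ≥ 1`:
`∫_{|z| ≥ r} |z|^{-t} dz = n |B₁| r^{n-t}/(t-n)` for `t > n`, `r > 0` (polar coordinates).
[folklore] -/
theorem integral_compl_ball_norm_rpow_neg (hn : 1 ≤ Module.finrank ℝ E) {t r : ℝ}
    (ht : (Module.finrank ℝ E : ℝ) < t) (hr : 0 < r) :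
    ∫ z in (ball (0 : E) r)ᶜ, ‖z‖ ^ (-t) ∂μ =
      Module.finrank ℝ E * μ.real (ball 0 1) *
        (r ^ ((Module.finrank ℝ E : ℝ) - t) / (t - Module.finrank ℝ E)) := by
  haveI : Nontrivial E := Module.nontrivial_of_finrank_pos hn
  set F : ℝ → ℝ := (Ici r).indicator fun y => y ^ (-t) with hF
  have h1 : ∫ z in (ball (0 : E) r)ᶜ, ‖z‖ ^ (-t) ∂μ = ∫ z, F ‖z‖ ∂μ := by
    rw [← integral_indicator measurableSet_ball.compl]
    congr 1
    funext z
    by_cases hz : z ∈ (ball (0 : E) r)ᶜ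
    · have : ‖z‖ ∈ Ici r := by simpa using hz
      rw [indicator_of_mem hz, hF, indicator_of_mem this]
    · have : ‖z‖ ∉ Ici r := by simpa using hz
      rw [indicator_of_notMem hz, hF, indicator_of_notMem this]
  rw [h1, integral_fun_norm_addHaar, hF, setIntegral_Ioi_pow_smul_indicator_rpow_neg hn ht hr,
    nsmul_eq_mul, smul_eq_mul, mul_assoc]

/-- `|z|^{-t}` is integrable off balls about the origin for `t > n` (`n ≥ 1`). [folklore] -/
theorem integrableOn_compl_ball_norm_rpow_neg (hn : 1 ≤ Module.finrank ℝ E) {t r : ℝ}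
    (ht : (Module.finrank ℝ E : ℝ) < t) (hr : 0 < r) :
    IntegrableOn (fun z : E => ‖z‖ ^ (-t)) (ball 0 r)ᶜ μ := by
  haveI : Nontrivial E := Module.nontrivial_of_finrank_pos hn
  set n := Module.finrank ℝ E with hn_def
  set F : ℝ → ℝ := (Ici r).indicator fun y => y ^ (-t) with hF
  have hFi : Integrable (fun z : E => F ‖z‖) μ := by
    rw [integrable_fun_norm_addHaar]
    have e : (fun y : ℝ => y ^ (n - 1) • F y) =
        (Ici r).indicator fun y => y ^ (n - 1) * y ^ (-t) := by
      funext y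
      rw [hF]
      by_cases hy : y ∈ Ici r
      · simp [indicator_of_mem hy]
      · simp [indicator_of_notMem hy]
    rw [e, IntegrableOn, integrable_indicator_iff measurableSet_Ici]
    have hI : IntegrableOn (fun y : ℝ => y ^ ((n : ℝ) - 1 - t)) (Ici r) volume := by
      rw [integrableOn_Ici_iff_integrableOn_Ioi]
      exact integrableOn_Ioi_rpow_of_lt (by linarith) hr
    have hI' : IntegrableOn (fun y : ℝ => y ^ ((n : ℝ) - 1 - t)) (Ici r) (volume.restrict (Ioi 0)) :=
      hI.mono_measure Measure.restrict_le_self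
    exact hI'.congr_fun (fun y hy => (pow_pred_mul_rpow_neg hn t (hr.trans_le hy)).symm)
      measurableSet_Ici
  have heq : (fun z : E => F ‖z‖) = (ball (0 : E) r)ᶜ.indicator fun z => ‖z‖ ^ (-t) := by
    funext z
    by_cases hz : z ∈ (ball (0 : E) r)ᶜ
    · have : ‖z‖ ∈ Ici r := by simpa using hz
      rw [indicator_of_mem hz, hF, indicator_of_mem this]
    · have : ‖z‖ ∉ Ici r := by simpa using hz
      rw [indicator_of_notMem hz, hF, indicator_of_notMem this]
  rw [heq, integrable_indicator_iff measurableSet_ball.compl] at hFi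
  exact hFi

/-- `ℝ≥0∞` form of `integral_compl_ball_norm_rpow_neg`. [folklore] -/
theorem lintegral_compl_ball_norm_rpow_neg (hn : 1 ≤ Module.finrank ℝ E) {t r : ℝ}
    (ht : (Module.finrank ℝ E : ℝ) < t) (hr : 0 < r) :
    ∫⁻ z in (ball (0 : E) r)ᶜ, ENNReal.ofReal (‖z‖ ^ (-t)) ∂μ =
      ENNReal.ofReal (Module.finrank ℝ E * μ.real (ball 0 1) *
        (r ^ ((Module.finrank ℝ E : ℝ) - t) / (t - Module.finrank ℝ E))) := by
  rw [← integral_compl_ball_norm_rpow_neg μ hn ht hr, ofReal_integral_eq_lintegral_ofReal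
    (integrableOn_compl_ball_norm_rpow_neg μ hn ht hr) (Eventually.of_forall fun z => by positivity)]

/-! ### Hörmander's condition from the gradient bound `|∇k(x)| ≤ C |x|^{-n-1}` -/

omit [FiniteDimensional ℝ E] [MeasurableSpace E] [BorelSpace E] in
/-- **Pointwise mean-value estimate** (Stein 1970, Ch. II §2.2): if `k` is differentiable off
the origin with `‖∇k(w)‖ ≤ C‖w‖^{-(n+1)}`, then for `|x| ≥ 2|y|`, `x ≠ 0`,
`|k(x - y) - k(x)| ≤ C 2^{n+1} |y| |x|^{-(n+1)}` (the segment from `x` to `x - y` stays in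
`|w| ≥ |x|/2`). [cite: Stein1971, Ch. II §2.2 (2)] -/
theorem abs_sub_le_of_norm_fderiv_le {k : E → ℝ} {C : ℝ} (hC : 0 ≤ C)
    (hd : ∀ z : E, z ≠ 0 → DifferentiableAt ℝ k z)
    (hk : ∀ z : E, z ≠ 0 → ‖fderiv ℝ k z‖ ≤ C * ‖z‖ ^ (-((Module.finrank ℝ E : ℝ) + 1)))
    {x y : E} (hx : x ≠ 0) (hxy : 2 * ‖y‖ ≤ ‖x‖) :
    |k (x - y) - k x| ≤
      C * 2 ^ ((Module.finrank ℝ E : ℝ) + 1) * ‖y‖ * ‖x‖ ^ (-((Module.finrank ℝ E : ℝ) + 1)) := by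
  set n : ℝ := (Module.finrank ℝ E : ℝ) with hn
  have hn0 : 0 ≤ n := Nat.cast_nonneg _
  have hxpos : 0 < ‖x‖ := norm_pos_iff.2 hx
  -- the ball `B̄(x, |y|)` avoids the origin: `|w| ≥ |x|/2`
  have hball : ∀ w ∈ closedBall x ‖y‖, ‖x‖ / 2 ≤ ‖w‖ := by
    intro w hw
    rw [mem_closedBall, dist_eq_norm] at hw
    have : ‖x‖ - ‖w - x‖ ≤ ‖w‖ := by
      have := norm_sub_norm_le x (x - w)
      rw [sub_sub_cancel, norm_sub_rev] at this
      linarith [norm_sub_rev x w]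
    linarith
  have hw0 : ∀ w ∈ closedBall x ‖y‖, w ≠ 0 := fun w hw h => by
    have := hball w hw
    rw [h, norm_zero] at this
    linarith
  have hbound : ∀ w ∈ closedBall x ‖y‖, ‖fderiv ℝ k w‖ ≤ C * (‖x‖ / 2) ^ (-(n + 1)) := by
    intro w hw
    refine (hk w (hw0 w hw)).trans (mul_le_mul_of_nonneg_left ?_ hC)
    exact Real.rpow_le_rpow_of_nonpos (by positivity) (hball w hw) (by linarith)
  have hmvt := Convex.norm_image_sub_le_of_norm_fderiv_le (fun w hw => hd w (hw0 w hw)) hbound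
    (convex_closedBall x ‖y‖) (mem_closedBall_self (norm_nonneg y))
    (show x - y ∈ closedBall x ‖y‖ by simp [mem_closedBall])
  rw [Real.norm_eq_abs, show x - y - x = -y by abel, norm_neg] at hmvt
  calc |k (x - y) - k x| ≤ C * (‖x‖ / 2) ^ (-(n + 1)) * ‖y‖ := hmvt
    _ = C * 2 ^ (n + 1) * ‖y‖ * ‖x‖ ^ (-(n + 1)) := by
        rw [Real.div_rpow hxpos.le zero_le_two, Real.rpow_neg zero_le_two, div_eq_mul_inv, inv_inv]
        ring

/-- **Hörmander's condition from the gradient bound** (Stein 1970, Ch. II §2.2: "`(2)`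
implies `(2')`"; §3.2 Theorem 2, hypothesis): if `k : E → ℝ` is differentiable off the origin
with `‖∇k(x)‖ ≤ C‖x‖^{-(n+1)}` (`n = dim E ≥ 1`), then for every `y`,
`∫_{|x| ≥ 2|y|} |k(x - y) - k(x)| dx ≤ C 2ⁿ n |B₁|`. [cite: Stein1971, Ch. II §2.2 (2')] -/
theorem lintegral_hormander_le_of_norm_fderiv_le (hn : 1 ≤ Module.finrank ℝ E) {k : E → ℝ}
    {C : ℝ} (hC : 0 ≤ C) (hd : ∀ z : E, z ≠ 0 → DifferentiableAt ℝ k z)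
    (hk : ∀ z : E, z ≠ 0 → ‖fderiv ℝ k z‖ ≤ C * ‖z‖ ^ (-((Module.finrank ℝ E : ℝ) + 1)))
    (y : E) :
    ∫⁻ x in {x : E | 2 * ‖y‖ ≤ ‖x‖}, ‖k (x - y) - k x‖ₑ ∂μ ≤
      ENNReal.ofReal (C * 2 ^ (Module.finrank ℝ E : ℝ) * (Module.finrank ℝ E * μ.real (ball 0 1))) := by
  set n : ℝ := (Module.finrank ℝ E : ℝ) with hn_def
  have hn1 : (1 : ℝ) ≤ n := by rw [hn_def]; exact_mod_cast hn
  rcases eq_or_ne y 0 with rfl | hy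
  · simp
  have hypos : 0 < ‖y‖ := norm_pos_iff.2 hy
  set S : Set E := {x : E | 2 * ‖y‖ ≤ ‖x‖} with hS
  have hSm : MeasurableSet S := measurableSet_le measurable_const measurable_norm
  -- pointwise bound on `S`
  have hpt : ∀ x ∈ S, ‖k (x - y) - k x‖ₑ ≤
      ENNReal.ofReal (C * 2 ^ (n + 1) * ‖y‖ * ‖x‖ ^ (-(n + 1))) := by
    intro x hx
    have hx2 : 2 * ‖y‖ ≤ ‖x‖ := hx
    have hx0 : x ≠ 0 := fun h => by rw [h, norm_zero] at hx2; linarith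
    rw [Real.enorm_eq_ofReal_abs]
    exact ENNReal.ofReal_le_ofReal (abs_sub_le_of_norm_fderiv_le hC hd hk hx0 hx2)
  calc ∫⁻ x in S, ‖k (x - y) - k x‖ₑ ∂μ
      ≤ ∫⁻ x in S, ENNReal.ofReal (C * 2 ^ (n + 1) * ‖y‖ * ‖x‖ ^ (-(n + 1))) ∂μ :=
        setLIntegral_mono' hSm hpt
    _ ≤ ∫⁻ x in (ball (0 : E) (2 * ‖y‖))ᶜ, ENNReal.ofReal (C * 2 ^ (n + 1) * ‖y‖ * ‖x‖ ^ (-(n + 1))) ∂μ := by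
        refine lintegral_mono_set fun x hx => ?_
        rw [mem_compl_iff, mem_ball_zero_iff, not_lt]
        exact hx
    _ = ENNReal.ofReal (C * 2 ^ (n + 1) * ‖y‖) *
          ∫⁻ x in (ball (0 : E) (2 * ‖y‖))ᶜ, ENNReal.ofReal (‖x‖ ^ (-(n + 1))) ∂μ := by
        rw [← lintegral_const_mul' _ _ ENNReal.ofReal_ne_top]
        refine lintegral_congr fun x => ?_
        rw [← ENNReal.ofReal_mul (by positivity)]
    _ = ENNReal.ofReal (C * 2 ^ (n + 1) * ‖y‖) *
          ENNReal.ofReal (n * μ.real (ball 0 1) * ((2 * ‖y‖) ^ (n - (n + 1)) / ((n + 1) - n))) := by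
        rw [lintegral_compl_ball_norm_rpow_neg μ hn (by linarith) (by positivity)]
    _ = ENNReal.ofReal (C * 2 ^ n * (n * μ.real (ball 0 1))) := by
        rw [← ENNReal.ofReal_mul (by positivity)]
        congr 1
        have h2 : (2 : ℝ) ^ (n + 1) = 2 ^ n * 2 := by rw [Real.rpow_add two_pos, Real.rpow_one]
        have h3 : (2 * ‖y‖) ^ (n - (n + 1)) = (2 * ‖y‖)⁻¹ := by
          rw [show n - (n + 1) = -1 by ring, Real.rpow_neg_one]
        have hy2 : (2 * ‖y‖) ≠ 0 := by positivity
        rw [h2, h3, show (n + 1) - n = (1 : ℝ) by ring, div_one]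
        calc C * (2 ^ n * 2) * ‖y‖ * (n * μ.real (ball 0 1) * (2 * ‖y‖)⁻¹)
            = C * 2 ^ n * (n * μ.real (ball 0 1)) * ((2 * ‖y‖) * (2 * ‖y‖)⁻¹) := by ring
          _ = C * 2 ^ n * (n * μ.real (ball 0 1)) := by rw [mul_inv_cancel₀ hy2, mul_one]

/-! ### Perturbations in `L¹` and subadditivity -/

omit [NormedSpace ℝ E] [FiniteDimensional ℝ E] in
/-- The trivial Hörmander bound for an integrable kernel: `∫_{|x|≥2|y|} |k(x-y) - k(x)| dx ≤ 2‖k‖₁`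
(translation invariance). [folklore] -/
theorem lintegral_hormander_le_two_mul_lintegral {k : E → ℝ} (hk : Measurable k) (y : E) :
    ∫⁻ x in {x : E | 2 * ‖y‖ ≤ ‖x‖}, ‖k (x - y) - k x‖ₑ ∂μ ≤ 2 * ∫⁻ x, ‖k x‖ₑ ∂μ := by
  have hm : Measurable fun x => ‖k (x - y)‖ₑ := (hk.comp (measurable_id.sub_const y)).enorm
  calc ∫⁻ x in {x : E | 2 * ‖y‖ ≤ ‖x‖}, ‖k (x - y) - k x‖ₑ ∂μ
      ≤ ∫⁻ x, ‖k (x - y) - k x‖ₑ ∂μ := setLIntegral_le_lintegral _ _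
    _ ≤ ∫⁻ x, ‖k (x - y)‖ₑ + ‖k x‖ₑ ∂μ := lintegral_mono fun x => enorm_sub_le
    _ = (∫⁻ x, ‖k (x - y)‖ₑ ∂μ) + ∫⁻ x, ‖k x‖ₑ ∂μ := lintegral_add_left hm _
    _ = (∫⁻ x, ‖k x‖ₑ ∂μ) + ∫⁻ x, ‖k x‖ₑ ∂μ := by
        rw [lintegral_sub_right_eq_self (fun x => ‖k x‖ₑ) y]
    _ = 2 * ∫⁻ x, ‖k x‖ₑ ∂μ := by rw [two_mul]

omit [NormedSpace ℝ E] [FiniteDimensional ℝ E] [μ.IsAddHaarMeasure] in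
/-- Subadditivity of the Hörmander integral in the kernel. [folklore] -/
theorem lintegral_hormander_add_le {k₁ k₂ : E → ℝ} (hk₁ : Measurable k₁) (y : E) :
    ∫⁻ x in {x : E | 2 * ‖y‖ ≤ ‖x‖}, ‖(k₁ + k₂) (x - y) - (k₁ + k₂) x‖ₑ ∂μ ≤
      (∫⁻ x in {x : E | 2 * ‖y‖ ≤ ‖x‖}, ‖k₁ (x - y) - k₁ x‖ₑ ∂μ) +
        ∫⁻ x in {x : E | 2 * ‖y‖ ≤ ‖x‖}, ‖k₂ (x - y) - k₂ x‖ₑ ∂μ := by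
  have hm : Measurable fun x => ‖k₁ (x - y) - k₁ x‖ₑ :=
    ((hk₁.comp (measurable_id.sub_const y)).sub hk₁).enorm
  calc ∫⁻ x in {x : E | 2 * ‖y‖ ≤ ‖x‖}, ‖(k₁ + k₂) (x - y) - (k₁ + k₂) x‖ₑ ∂μ
      ≤ ∫⁻ x in {x : E | 2 * ‖y‖ ≤ ‖x‖}, ‖k₁ (x - y) - k₁ x‖ₑ + ‖k₂ (x - y) - k₂ x‖ₑ ∂μ := by
        refine lintegral_mono fun x => ?_
        have : (k₁ + k₂) (x - y) - (k₁ + k₂) x = (k₁ (x - y) - k₁ x) + (k₂ (x - y) - k₂ x) := by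
          simp only [Pi.add_apply]; ring
        rw [this]
        exact enorm_add_le _ _
    _ = _ := lintegral_add_left hm _

/-- **Hörmander's condition for a kernel `k₁ + k₂` with `|∇k₁| ≤ C|x|^{-n-1}` off the origin and
`k₂ ∈ L¹`**: `∫_{|x|≥2|y|} |k(x-y) - k(x)| dx ≤ C 2ⁿ n|B₁| + 2‖k₂‖₁` (Stein 1970, Ch. II §3.2–3.4:
the truncated kernels satisfy the same conditions with comparable bounds). [cite: Stein1971, Ch. II §3.2 Thm 2] -/
theorem lintegral_hormander_le_of_norm_fderiv_le_add (hn : 1 ≤ Module.finrank ℝ E)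
    {k₁ k₂ : E → ℝ} (hk₁m : Measurable k₁) (hk₂m : Measurable k₂) {C : ℝ} (hC : 0 ≤ C)
    (hd : ∀ z : E, z ≠ 0 → DifferentiableAt ℝ k₁ z)
    (hk : ∀ z : E, z ≠ 0 → ‖fderiv ℝ k₁ z‖ ≤ C * ‖z‖ ^ (-((Module.finrank ℝ E : ℝ) + 1)))
    (y : E) :
    ∫⁻ x in {x : E | 2 * ‖y‖ ≤ ‖x‖}, ‖(k₁ + k₂) (x - y) - (k₁ + k₂) x‖ₑ ∂μ ≤
      ENNReal.ofReal (C * 2 ^ (Module.finrank ℝ E : ℝ) * (Module.finrank ℝ E * μ.real (ball 0 1))) +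
        2 * ∫⁻ x, ‖k₂ x‖ₑ ∂μ :=
  (lintegral_hormander_add_le μ hk₁m y).trans (add_le_add
    (lintegral_hormander_le_of_norm_fderiv_le μ hn hC hd hk y)
    (lintegral_hormander_le_two_mul_lintegral μ hk₂m y))

end Literature.Analysis.SingularIntegrals
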